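import Summits.CriticalPhenomena.PercolationContinuityZ3.Theorems.PercNearOneGluingNoHeavyLowerTailCubicThreePointBernsteinStep
import Mathlib.Tactic.Linarith
import Mathlib.Tactic.Ring
import Mathlib.Tactic.Positivity
import HarnessLib

/-!
# `NoHeavyLowerTail` (stmt-CriticalPhenomena-4575) — SHK3⁺ terminal-edge induction: the two EASY apex steps are automatic

Support file (prover prim-ineq-gen-2 gen 2, new-inequality factory; `--supports stmt-CriticalPhenomena-4575`).  Pure algebra over a
commutative ring / `ℝ`: no measure theory, no definitions, no named facts, no sorries.  Companion of
`PercNearOneGluingNoHeavyLowerTailCubicThreePointBernsteinStep` (prim-ineq-prove-2): same cubic `F`, same Bernstein coefficients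
`threeB₁`, `threeB₂`, same cell convention `(q,u₁,u₂,u₃,t) = (P(a|b|c), P(ab|c), P(ac|b), P(bc|a), P(abc))`, same apex-`a` transition
masses `α₁ (a|b|c → ab|c)`, `α₂ (a|b|c → ac|b)`, `β₁ (ab|c → abc)`, `β₂ (ac|b → abc)`, `β₃ (bc|a → abc)`.

WHAT.  `CubicThreePointInduction.shk3W_nonneg_of_stepHyp` reduces SHK3⁺ (`F ≥ 0`, = Richards–Sahi `E₃ ≥ 0` on the three pairwise
separations) to the hypothesis `StepHyp`: `threeB₁ ≥ 0` and `threeB₂ ≥ 0` for EVERY apex edge `e = {x, m}` (`x` forced-joined to the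
apex terminal `a`).  Two families of apex edges need no hypothesis at all — their Bernstein coefficients are explicit nonnegative
combinations of Gladkov's quadratic row `AG = q t − e₂(u) ≥ 0` (tree: `prodBernoulli_threePoint_strongHarris`) and of cell products:
* TERMINAL–TERMINAL apex edge (`m = b`, i.e. `m` forced-joined to `b`): opening `e` glues `a` to `b`, so the whole cell `a|b|c` moves to
  `ab|c` and the whole cells `ac|b`, `bc|a` move to `abc`: `(α₁,α₂,β₁,β₂,β₃) = (q, 0, 0, u₂, u₃)` and
  `threeB₁ = AG·(2σ + 2t + u₂ + u₃) + u₂u₃(u₂ + u₃ + 2t)`,  `threeB₂ = (σ + t + u₂ + u₃)·(q t − u₁(u₂+u₃))`  (`σ` = total mass;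
  `q t − u₁(u₂+u₃) = AG + u₂u₃`): `threeB₁_terminal`, `threeB₂_terminal`, nonnegativity `threeB₁_terminal_nonneg`, `threeB₂_terminal_nonneg`.
* PENDANT apex (`e = {a, m}` is the only edge at `a`, nothing forced at `a`): before opening `e` the apex is isolated, the law is
  `x⁰ = (Q+v₁+v₂, 0, 0, v₃+T, 0)` where `(Q,v₁,v₂,v₃,T)` is the three-point law of `(m,b,c)` (= the law `x¹` of `G/e` with `a ≡ m`), and
  `(α₁,α₂,β₁,β₂,β₃) = (v₁, v₂, 0, 0, T)`:  `threeB₁ = σ'·(AG' + v₁v₂)`,  `threeB₂ = AG'·(2σ' + T) + v₁v₂(σ' − v₃)`  with `AG' = QT − e₂(v)`,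
  `σ' = Q+v₁+v₂+v₃+T`: `threeB₁_pendant`, `threeB₂_pendant`, `…_nonneg`.
So `StepHyp` may be restricted to apex edges `{x,m}` with `m` NOT joined to a terminal and the apex cluster not a single pendant vertex; the
same algebra covers a cut vertex separating one terminal from the other two (pendant BLOB, `p ↦ P(a ~ cut vertex)`).
ALSO RECORDED (chord form of the same two steps, used by the factory's 'exists-a-good-edge' analysis, memo
run/shared/lean/prim/prim-ineq-gen-2/EDGE-STEP.md): along the terminal–terminal segment `x_l = (1−l)x⁰ + l x¹` the sharper cubic rows satisfy
the EXACT identities `AG⁺(x_l) = (1−l)·AG⁺(x⁰) + l(1−l)·u₂u₃(σ + u₁ − (1−l)q)` (`agPlus_terminal_chord`, AG⁺ := σ·AG − e₃, Gladkov–prim 'G3'),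
`Hb(x_l) = (1−l)²·Hb(x⁰)` (`hb_terminal_chord`, `Hb := q·AG − e₃`, the triangle-tight sheet of SF3-Hmax) and, for the pendant segment,
`Ha(x_l) = l²·Ha(x¹)` (`ha_pendant_chord`, `Ha := t·AG − e₃`, the star-tight sheet); hence `AG⁺(G) ≥ (1−w_e)·AG⁺(G∖e)` for a terminal–terminal
edge and the sign of `Hb` (`Ha`) is invariant under adding terminal–terminal (pendant-terminal) edges.
Numerics behind the file (this seat, 2026-08-19): 0 exceptions to the closed forms on 2·10⁴ random points (1e-13); bern4 census (ttrl2): B1, B2 ≥ 0 on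
3.1·10⁶ exact instances.  [cite: Gladkov2024StrongFKG, Cor. 4.2 (the quadratic row AG ≥ 0)]; [cite: GladkovZimin2024HK, §4 (one-edge split)]
-/

namespace Summit.CriticalPhenomena.PercolationContinuityZ3.Theorems

namespace CubicThreePointStep

section Identities

variable {R : Type*} [CommRing R]

/-- **Terminal–terminal apex edge, first Bernstein coefficient.**  With transitions `(α₁,α₂,β₁,β₂,β₃) = (q,0,0,u₂,u₃)` (the apex edge
glues `a` to `b`):  `threeB₁ = (q t − e₂(u))·(2σ + 2t + u₂ + u₃) + u₂u₃(u₂ + u₃ + 2t)`, `σ = q+u₁+u₂+u₃+t` (polynomial identity). [folklore] -/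
theorem threeB₁_terminal (q u₁ u₂ u₃ t : R) :
    threeB₁ q u₁ u₂ u₃ t q 0 0 u₂ u₃ =
      (q * t - (u₁ * u₂ + u₁ * u₃ + u₂ * u₃)) * (2 * (q + u₁ + u₂ + u₃ + t) + 2 * t + u₂ + u₃) +
        u₂ * u₃ * (u₂ + u₃ + 2 * t) := by
  simp only [threeB₁]
  ring

/-- **Terminal–terminal apex edge, second Bernstein coefficient.**  With transitions `(q,0,0,u₂,u₃)`:
`threeB₂ = (σ + t + u₂ + u₃)·(q t − u₁(u₂ + u₃))` (and `q t − u₁(u₂+u₃) = AG + u₂u₃`). [folklore] -/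
theorem threeB₂_terminal (q u₁ u₂ u₃ t : R) :
    threeB₂ q u₁ u₂ u₃ t q 0 0 u₂ u₃ =
      ((q + u₁ + u₂ + u₃ + t) + t + u₂ + u₃) * (q * t - u₁ * (u₂ + u₃)) := by
  simp only [threeB₂]
  ring

/-- **Pendant apex edge, first Bernstein coefficient.**  Apex isolated before the edge opens: `x⁰ = (Q+v₁+v₂, 0, 0, v₃+T, 0)` built from
the law `(Q,v₁,v₂,v₃,T)` of `(m,b,c)`, transitions `(v₁,v₂,0,0,T)`:  `threeB₁ = σ'·(QT − e₂(v) + v₁v₂)`, `σ' = Q+v₁+v₂+v₃+T`. [folklore] -/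
theorem threeB₁_pendant (Q v₁ v₂ v₃ T : R) :
    threeB₁ (Q + v₁ + v₂) 0 0 (v₃ + T) 0 v₁ v₂ 0 0 T =
      (Q + v₁ + v₂ + v₃ + T) * (Q * T - (v₁ * v₂ + v₁ * v₃ + v₂ * v₃) + v₁ * v₂) := by
  simp only [threeB₁]
  ring

/-- **Pendant apex edge, second Bernstein coefficient.**  Same data: `threeB₂ = (QT − e₂(v))·(2σ' + T) + v₁v₂(σ' − v₃)`. [folklore] -/
theorem threeB₂_pendant (Q v₁ v₂ v₃ T : R) :
    threeB₂ (Q + v₁ + v₂) 0 0 (v₃ + T) 0 v₁ v₂ 0 0 T =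
      (Q * T - (v₁ * v₂ + v₁ * v₃ + v₂ * v₃)) * (2 * (Q + v₁ + v₂ + v₃ + T) + T) +
        v₁ * v₂ * ((Q + v₁ + v₂ + v₃ + T) - v₃) := by
  simp only [threeB₂]
  ring

/-- **Terminal–terminal chord identity for `AG⁺ := σ·(qt − e₂) − e₃`** (the cubic row 'G3' = `qt ≥ e₂ + e₃` of the factory):
along `x_l = (1−l)x⁰ + l x¹`, `x¹ = (0, q+u₁, 0, 0, t+u₂+u₃)` (apex glued to `b`),
`AG⁺(x_l) = (1−l)·AG⁺(x⁰) + l(1−l)·u₂u₃·(σ + u₁ − (1−l)q)`.  In particular `AG⁺(x¹) = 0`. [folklore] -/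
theorem agPlus_terminal_chord (q u₁ u₂ u₃ t l : R) :
    ((1 - l) * q + l * 0 + ((1 - l) * u₁ + l * (q + u₁)) + (1 - l) * u₂ + (1 - l) * u₃ + ((1 - l) * t + l * (t + u₂ + u₃))) *
          (((1 - l) * q) * ((1 - l) * t + l * (t + u₂ + u₃)) -
            (((1 - l) * u₁ + l * (q + u₁)) * ((1 - l) * u₂) + ((1 - l) * u₁ + l * (q + u₁)) * ((1 - l) * u₃) +
              ((1 - l) * u₂) * ((1 - l) * u₃))) -
        ((1 - l) * u₁ + l * (q + u₁)) * ((1 - l) * u₂) * ((1 - l) * u₃) =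
      (1 - l) * ((q + u₁ + u₂ + u₃ + t) * (q * t - (u₁ * u₂ + u₁ * u₃ + u₂ * u₃)) - u₁ * u₂ * u₃) +
        l * (1 - l) * (u₂ * u₃ * ((q + u₁ + u₂ + u₃ + t) + u₁ - (1 - l) * q)) := by
  ring

/-- **Terminal–terminal chord identity for `Hb := q·(qt − e₂) − e₃`** (the triangle-tight sheet of SF3-Hmax): along the same segment
`Hb(x_l) = (1−l)²·Hb(x⁰)` — adding a terminal–terminal edge of weight `l` multiplies `Hb` by `(1−l)²`. [folklore] -/
theorem hb_terminal_chord (q u₁ u₂ u₃ t l : R) :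
    ((1 - l) * q) *
          (((1 - l) * q) * ((1 - l) * t + l * (t + u₂ + u₃)) -
            (((1 - l) * u₁ + l * (q + u₁)) * ((1 - l) * u₂) + ((1 - l) * u₁ + l * (q + u₁)) * ((1 - l) * u₃) +
              ((1 - l) * u₂) * ((1 - l) * u₃))) -
        ((1 - l) * u₁ + l * (q + u₁)) * ((1 - l) * u₂) * ((1 - l) * u₃) =
      (1 - l) ^ 2 * (q * (q * t - (u₁ * u₂ + u₁ * u₃ + u₂ * u₃)) - u₁ * u₂ * u₃) := by
  ring

/-- **Pendant chord identity for `Ha := t·(qt − e₂) − e₃`** (the star-tight sheet of SF3-Hmax): along the pendant segment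
`x_l = (1−l)x⁰ + l x¹`, `x⁰ = (Q+v₁+v₂, 0, 0, v₃+T, 0)`, `x¹ = (Q,v₁,v₂,v₃,T)`: `Ha(x_l) = l²·Ha(x¹)` — hanging a terminal by an edge of
weight `l` multiplies `Ha` by `l²`. [folklore] -/
theorem ha_pendant_chord (Q v₁ v₂ v₃ T l : R) :
    (l * T) *
          (((1 - l) * (Q + v₁ + v₂) + l * Q) * (l * T) -
            ((l * v₁) * (l * v₂) + (l * v₁) * ((1 - l) * (v₃ + T) + l * v₃) + (l * v₂) * ((1 - l) * (v₃ + T) + l * v₃))) -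
        (l * v₁) * (l * v₂) * ((1 - l) * (v₃ + T) + l * v₃) =
      l ^ 2 * (T * (Q * T - (v₁ * v₂ + v₁ * v₃ + v₂ * v₃)) - v₁ * v₂ * v₃) := by
  ring

end Identities

/-! ### Nonnegativity: the two easy cases of `StepHyp` follow from Gladkov's quadratic row -/

/-- **`StepHyp` is automatic at a terminal–terminal apex edge (B1).**  For nonnegative cells with `AG = qt − e₂(u) ≥ 0`,
`0 ≤ threeB₁ q u₁ u₂ u₃ t q 0 0 u₂ u₃`. [folklore] -/
theorem threeB₁_terminal_nonneg {q u₁ u₂ u₃ t : ℝ} (hq : 0 ≤ q) (h₁ : 0 ≤ u₁) (h₂ : 0 ≤ u₂) (h₃ : 0 ≤ u₃) (ht : 0 ≤ t)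
    (hAG : 0 ≤ q * t - (u₁ * u₂ + u₁ * u₃ + u₂ * u₃)) :
    0 ≤ threeB₁ q u₁ u₂ u₃ t q 0 0 u₂ u₃ := by
  rw [threeB₁_terminal]
  have h23 : 0 ≤ u₂ * u₃ := mul_nonneg h₂ h₃
  have hA : 0 ≤ (q * t - (u₁ * u₂ + u₁ * u₃ + u₂ * u₃)) * (2 * (q + u₁ + u₂ + u₃ + t) + 2 * t + u₂ + u₃) :=
    mul_nonneg hAG (by linarith)
  have hB : 0 ≤ u₂ * u₃ * (u₂ + u₃ + 2 * t) := mul_nonneg h23 (by linarith)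
  linarith

/-- **`StepHyp` is automatic at a terminal–terminal apex edge (B2).**  For nonnegative cells with `AG ≥ 0`,
`0 ≤ threeB₂ q u₁ u₂ u₃ t q 0 0 u₂ u₃` (only `qt ≥ u₁(u₂+u₃)`, weaker than AG, is used). [folklore] -/
theorem threeB₂_terminal_nonneg {q u₁ u₂ u₃ t : ℝ} (hq : 0 ≤ q) (h₁ : 0 ≤ u₁) (h₂ : 0 ≤ u₂) (h₃ : 0 ≤ u₃) (ht : 0 ≤ t)
    (hAG : 0 ≤ q * t - (u₁ * u₂ + u₁ * u₃ + u₂ * u₃)) :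
    0 ≤ threeB₂ q u₁ u₂ u₃ t q 0 0 u₂ u₃ := by
  rw [threeB₂_terminal]
  have h23 : 0 ≤ u₂ * u₃ := mul_nonneg h₂ h₃
  have hA : 0 ≤ q * t - u₁ * (u₂ + u₃) := by nlinarith
  exact mul_nonneg (by linarith) hA

/-- **`StepHyp` is automatic at a pendant apex edge (B1).**  For a nonnegative law `(Q,v₁,v₂,v₃,T)` of `(m,b,c)` with Gladkov's
`AG' = QT − e₂(v) ≥ 0`, `0 ≤ threeB₁ (Q+v₁+v₂) 0 0 (v₃+T) 0 v₁ v₂ 0 0 T`. [folklore] -/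
theorem threeB₁_pendant_nonneg {Q v₁ v₂ v₃ T : ℝ} (hQ : 0 ≤ Q) (h₁ : 0 ≤ v₁) (h₂ : 0 ≤ v₂) (h₃ : 0 ≤ v₃) (hT : 0 ≤ T)
    (hAG : 0 ≤ Q * T - (v₁ * v₂ + v₁ * v₃ + v₂ * v₃)) :
    0 ≤ threeB₁ (Q + v₁ + v₂) 0 0 (v₃ + T) 0 v₁ v₂ 0 0 T := by
  rw [threeB₁_pendant]
  have h12 : 0 ≤ v₁ * v₂ := mul_nonneg h₁ h₂
  exact mul_nonneg (by linarith) (by linarith)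

/-- **`StepHyp` is automatic at a pendant apex edge (B2).**  Same data: `0 ≤ threeB₂ (Q+v₁+v₂) 0 0 (v₃+T) 0 v₁ v₂ 0 0 T`. [folklore] -/
theorem threeB₂_pendant_nonneg {Q v₁ v₂ v₃ T : ℝ} (hQ : 0 ≤ Q) (h₁ : 0 ≤ v₁) (h₂ : 0 ≤ v₂) (h₃ : 0 ≤ v₃) (hT : 0 ≤ T)
    (hAG : 0 ≤ Q * T - (v₁ * v₂ + v₁ * v₃ + v₂ * v₃)) :
    0 ≤ threeB₂ (Q + v₁ + v₂) 0 0 (v₃ + T) 0 v₁ v₂ 0 0 T := by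
  rw [threeB₂_pendant]
  have h12 : 0 ≤ v₁ * v₂ := mul_nonneg h₁ h₂
  have hA : 0 ≤ (Q * T - (v₁ * v₂ + v₁ * v₃ + v₂ * v₃)) * (2 * (Q + v₁ + v₂ + v₃ + T) + T) :=
    mul_nonneg hAG (by linarith)
  have hB : 0 ≤ v₁ * v₂ * ((Q + v₁ + v₂ + v₃ + T) - v₃) := mul_nonneg h12 (by linarith)
  linarith

/-- **The terminal–terminal edge is 'good' for `AG⁺`.**  For a nonnegative law `x⁰` (cells of `G∖e`, total mass `σ` with `q ≤ σ`) and
`l ∈ [0,1]`, the chord defect of `AG⁺ = σ·AG − e₃` along the terminal–terminal segment is nonnegative, so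
`AG⁺(x_l) ≥ (1−l)·AG⁺(x⁰)`: adding an edge between two terminals preserves `AG⁺ ≥ 0`. [folklore] -/
theorem agPlus_terminal_chord_nonneg {q u₁ u₂ u₃ t l : ℝ} (hq : 0 ≤ q) (h₁ : 0 ≤ u₁) (h₂ : 0 ≤ u₂) (h₃ : 0 ≤ u₃) (ht : 0 ≤ t)
    (hl₀ : 0 ≤ l) (hl₁ : l ≤ 1) :
    0 ≤ l * (1 - l) * (u₂ * u₃ * ((q + u₁ + u₂ + u₃ + t) + u₁ - (1 - l) * q)) := by
  have hm : 0 ≤ 1 - l := by linarith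
  have h23 : 0 ≤ u₂ * u₃ := mul_nonneg h₂ h₃
  have hin : 0 ≤ (q + u₁ + u₂ + u₃ + t) + u₁ - (1 - l) * q := by nlinarith
  exact mul_nonneg (mul_nonneg hl₀ hm) (mul_nonneg h23 hin)

end CubicThreePointStep

end Summit.CriticalPhenomena.PercolationContinuityZ3.Theorems
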